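import Mathlib.Analysis.Calculus.ContDiff.RCLike
import Mathlib.Analysis.Complex.CauchyIntegral
import Literature.Probability.RandomPlanarGeometry.CaratheodoryHalfPlaneProofs
import Literature.Probability.RandomPlanarGeometry.ConformalMapCaratheodoryProofs
import Literature.Probability.RandomPlanarGeometry.BoundaryCorrespondence
import Literature.Probability.RandomPlanarGeometry.ChordalBoundary
import Literature.Probability.RandomPlanarGeometry.ConformalRectangle
import Literature.Probability.RandomPlanarGeometry.ConformalMap
import Literature.Analysis.Complex.SchwarzReflection

/-!
# Flat-window transport for chordal uniformizing maps (line `boundary-area-law`, stub S6b)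

Line `boundary-area-law` of the crux `SubseqIdentification` (stmt-CriticalPhenomena-0783), stub
S6b `stub_windowTransport` — pure complex analysis, no probability.

Let `(D; a, b)` be a Dobrushin domain with a FLAT HORIZONTAL WINDOW
`D ∩ B(x₀, ρ₀) = {im z > im x₀} ∩ B(x₀, ρ₀)` at a wall point `x₀ ∉ {a, b}`, and let `φ : ℍ → D` be
a chordal uniformizing map (`0 ↦ a`, `∞ ↦ b`) with boundary extension `Φ = φ.boundaryExtension`
(continuous on `ℍ̄` by Carathéodory, `JordanDomain.continuousOn_boundaryExtension_holds`). Then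
`x₀ = Φ(u₀)` for a real `u₀ ≠ 0`, and `Φ` is two-sidedly Lipschitz AT `u₀` relative to the
closed half-plane: `|Φ(u) − x₀| ≤ L |u − u₀|` for `im u ≥ 0`, `|u − u₀| < η`, and
`|u − u₀| ≤ L |Φ(u) − x₀|` for `im u ≥ 0`, `|Φ(u) − x₀| < η` (`stub_windowTransport`).

Proof (all ingredients in the tree).
* `window_mem_iff` — inside the window, membership in `D`, `closure D`, `frontier D` is read off
  the imaginary part.
* `exists_inverse_upTo_boundary` — from Carathéodory's theorem in disc form
  (`JordanDomain.exists_continuousOn_extension_holds`: the extension `Ψ` of `φ ∘ C⁻¹` to the closed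
  disc is a continuous bijection onto `closure D`, hence has a continuous inverse,
  `IsCompact.continuousOn_invFunOn`) the map `G = C⁻¹ ∘ Ψ⁻¹` is holomorphic on `D` (`= φ⁻¹`),
  continuous on `closure D ∖ {b}`, real on `∂D`, and `G ∘ Φ = id` on `ℍ̄`, `Φ ∘ G = id` on
  `closure D ∖ {b}`.
* `exists_norm_sub_le_of_window` — ONE-SIDED LIPSCHITZ BOUND AT A FLAT WALL: a function holomorphic
  in the window, continuous up to the wall and real on it, reflects (Schwarz,
  `Complex.differentiableOn_schwarzReflection`) to a holomorphic function on the whole ball, which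
  is `C¹`, hence Lipschitz near the centre (`ContDiffAt.exists_lipschitzOnWith`).
* The second clause is this bound for `G` at the wall point `x₀` of `D`; the first clause is the
  same bound for `Φ − x₀` at the wall point `u₀` of `ℍ` (its values at real points near `u₀` lie on
  `∂D ∩ B(x₀, ρ₀)`, the wall line, so `Φ − x₀` is real there); `u₀ ≠ 0` because `Φ(0) = a ≠ x₀`.

References: Ch. Pommerenke, *Boundary Behaviour of Conformal Maps* (1992), Thm. 2.6;
J. B. Conway, *Functions of One Complex Variable I* (1978), IX.1.1 (Schwarz reflection).
-/

noncomputable section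

open MeasureTheory Filter Topology Set Metric Complex
open scoped ComplexConjugate NNReal
open Literature.Probability.RandomPlanarGeometry
open UpperHalfPlane (upperHalfPlaneSet isOpen_upperHalfPlaneSet)

namespace Summit.CriticalPhenomena.SAWScalingLimit.Theorems.SubseqIdentification.BoundaryAreaLaw

/-! ### Local Lipschitz bounds for holomorphic functions -/

/-- A function holomorphic on a ball is Lipschitz at the centre on a smaller ball (holomorphic
⇒ `C¹` ⇒ locally Lipschitz). [folklore] -/
theorem norm_sub_le_of_differentiableOn_ball {F : ℂ → ℂ} {c : ℂ} {r : ℝ} (hr : 0 < r)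
    (hF : DifferentiableOn ℂ F (ball c r)) :
    ∃ K η : ℝ, 0 ≤ K ∧ 0 < η ∧ η ≤ r ∧ ∀ z ∈ ball c η, ‖F z - F c‖ ≤ K * ‖z - c‖ := by
  have hcd : ContDiffAt ℂ 1 F c :=
    (hF.contDiffOn isOpen_ball).contDiffAt (ball_mem_nhds c hr)
  obtain ⟨K, t, ht, hK⟩ := hcd.exists_lipschitzOnWith
  obtain ⟨η, hη, hηt⟩ := Metric.mem_nhds_iff.1 ht
  refine ⟨K, min η r, K.coe_nonneg, lt_min hη hr, min_le_right _ _, fun z hz ↦ ?_⟩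
  have hz' : z ∈ t := hηt (ball_subset_ball (min_le_left _ _) hz)
  have hc' : c ∈ t := hηt (mem_ball_self hη)
  rw [← dist_eq_norm, ← dist_eq_norm]
  exact hK.dist_le_mul z hz' c hc'

/-! ### Window geometry -/

/-- **Window geometry.** If `V` is open and `V ∩ B(x₀, ρ)` is the open upper half of the ball,
then inside the ball membership in `V`, in `closure V` and in `frontier V` is read off the
imaginary part. [folklore] -/
theorem window_mem_iff {V : Set ℂ} (hV : IsOpen V) {x₀ : ℂ} {ρ : ℝ}
    (hwin : V ∩ ball x₀ ρ = {z : ℂ | x₀.im < z.im} ∩ ball x₀ ρ) {z : ℂ} (hz : z ∈ ball x₀ ρ) :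
    (z ∈ V ↔ x₀.im < z.im) ∧ (z ∈ closure V ↔ x₀.im ≤ z.im) ∧
      (z ∈ frontier V ↔ z.im = x₀.im) := by
  have h1 : z ∈ V ↔ x₀.im < z.im := by
    constructor
    · intro h
      have h' : z ∈ V ∩ ball x₀ ρ := ⟨h, hz⟩
      rw [hwin] at h'
      exact h'.1
    · intro h
      have h' : z ∈ {z : ℂ | x₀.im < z.im} ∩ ball x₀ ρ := ⟨h, hz⟩
      rw [← hwin] at h'
      exact h'.1
  have h2 : z ∈ closure V ↔ x₀.im ≤ z.im := by
    constructor
    · intro h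
      have h' : z ∈ closure (V ∩ ball x₀ ρ) := isOpen_ball.closure_inter ⟨h, hz⟩
      rw [hwin] at h'
      have h'' : z ∈ closure {z : ℂ | x₀.im < z.im} := closure_mono inter_subset_left h'
      rwa [closure_setOf_lt_im] at h''
    · intro h
      have h' : z ∈ closure {z : ℂ | x₀.im < z.im} := by rwa [closure_setOf_lt_im]
      have h'' : z ∈ closure ({z : ℂ | x₀.im < z.im} ∩ ball x₀ ρ) :=
        isOpen_ball.closure_inter ⟨h', hz⟩
      rw [← hwin] at h''
      exact closure_mono inter_subset_left h''
  refine ⟨h1, h2, ?_⟩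
  rw [hV.frontier_eq, Set.mem_sdiff, h1, h2, not_lt]
  exact ⟨fun h ↦ le_antisymm h.2 h.1, fun h ↦ ⟨h.ge, h.le⟩⟩

/-- A flat window stays a flat window at every smaller radius. [folklore] -/
theorem window_mono {V : Set ℂ} {x₀ : ℂ} {ρ ρ' : ℝ}
    (hwin : V ∩ ball x₀ ρ = {z : ℂ | x₀.im < z.im} ∩ ball x₀ ρ) (h : ρ' ≤ ρ) :
    V ∩ ball x₀ ρ' = {z : ℂ | x₀.im < z.im} ∩ ball x₀ ρ' := by
  have hsub : ball x₀ ρ ∩ ball x₀ ρ' = ball x₀ ρ' :=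
    inter_eq_self_of_subset_right (ball_subset_ball h)
  rw [← hsub, ← inter_assoc, hwin, inter_assoc]

/-! ### One-sided Lipschitz bound at a flat wall by Schwarz reflection -/

/-- **One-sided Lipschitz bound at a flat wall.** Let `V` be open with a flat horizontal window
`V ∩ B(x₀, ρ) = {im > im x₀} ∩ B(x₀, ρ)`, and let `G` be holomorphic on `V ∩ B(x₀, ρ)`, continuous
on `closure V ∩ B(x₀, ρ)` and real-valued on `frontier V ∩ B(x₀, ρ)` (the wall segment). Then
`‖G (x₀ + z) - G x₀‖ ≤ K ‖z‖` for `im z ≥ 0`, `‖z‖ < η`: the Schwarz reflection of `z ↦ G (x₀ + z)`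
across the real axis is holomorphic on `B(0, ρ)` (Conway IX.1.1), hence locally Lipschitz.
[folklore] -/
theorem exists_norm_sub_le_of_window {V : Set ℂ} (hV : IsOpen V) {x₀ : ℂ} {ρ : ℝ} (hρ : 0 < ρ)
    (hwin : V ∩ ball x₀ ρ = {z : ℂ | x₀.im < z.im} ∩ ball x₀ ρ) {G : ℂ → ℂ}
    (hGd : DifferentiableOn ℂ G (V ∩ ball x₀ ρ)) (hGc : ContinuousOn G (closure V ∩ ball x₀ ρ))
    (hGreal : ∀ w ∈ frontier V ∩ ball x₀ ρ, (G w).im = 0) :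
    ∃ K η : ℝ, 0 ≤ K ∧ 0 < η ∧ η ≤ ρ ∧
      ∀ z ∈ ball (0 : ℂ) η, 0 ≤ z.im → ‖G (x₀ + z) - G x₀‖ ≤ K * ‖z‖ := by
  have hmemball : ∀ z ∈ ball (0 : ℂ) ρ, x₀ + z ∈ ball x₀ ρ := fun z hz ↦ by
    rwa [mem_ball, dist_eq_norm, add_sub_cancel_left, ← mem_ball_zero_iff]
  obtain ⟨g, hg⟩ : ∃ g : ℂ → ℂ, ∀ z, g z = G (x₀ + z) := ⟨_, fun z ↦ rfl⟩
  have hgd : DifferentiableOn ℂ (schwarzReflection g) (ball 0 ρ) := by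
    refine differentiableOn_schwarzReflection isOpen_ball (fun z hz ↦ ?_) ?_ ?_ ?_
    · rwa [mem_ball_zero_iff, Complex.norm_conj, ← mem_ball_zero_iff]
    · rw [funext hg]
      refine hGc.comp (continuous_const.add continuous_id).continuousOn fun z hz ↦
        ⟨?_, hmemball z hz.1⟩
      refine ((window_mem_iff hV hwin (hmemball z hz.1)).2.1).2 ?_
      have h0 : 0 ≤ z.im := hz.2
      rw [add_im]
      linarith
    · rw [funext hg]
      refine hGd.comp ((differentiableOn_const x₀).add differentiableOn_id) fun z hz ↦
        ⟨?_, hmemball z hz.1⟩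
      refine ((window_mem_iff hV hwin (hmemball z hz.1)).1).2 ?_
      have h0 : 0 < z.im := hz.2
      show x₀.im < (x₀ + z).im
      rw [add_im]
      linarith
    · intro z hz hzim
      rw [hg]
      refine conj_eq_iff_im.2 (hGreal _ ⟨?_, hmemball z hz⟩)
      refine ((window_mem_iff hV hwin (hmemball z hz)).2.2).2 ?_
      rw [add_im, hzim, add_zero]
  obtain ⟨K, η, hK, hη, hηρ, hLip⟩ := norm_sub_le_of_differentiableOn_ball hρ hgd
  refine ⟨K, η, hK, hη, hηρ, fun z hz hzim ↦ ?_⟩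
  have h1 := hLip z hz
  rwa [schwarzReflection_of_nonneg hzim, schwarzReflection_of_nonneg (by simp), sub_zero, hg, hg,
    add_zero] at h1

/-! ### The inverse of a chordal uniformizing map up to the boundary -/

/-- **The inverse up to the boundary** (Carathéodory, disc form, Pommerenke Thm. 2.6). For a
chordal uniformizing map `φ : (ℍ; 0, ∞) → (D; a, b)` there is `G : ℂ → ℂ` (namely
`C⁻¹ ∘ Ψ⁻¹`, `Ψ` the Carathéodory extension of `φ ∘ C⁻¹` to the closed disc, `C` the Cayley map)
with: `G (Φ u) = u` for `im u ≥ 0` (`Φ = φ.boundaryExtension`); `G` holomorphic on `D` (it is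
`φ⁻¹` there); `G` continuous on `closure D ∖ {b}`; `G` real on `∂D`; and for
`w ∈ closure D ∖ {b}`, `im (G w) ≥ 0` and `Φ (G w) = w`. [folklore] -/
theorem exists_inverse_upTo_boundary {D : DobrushinDomain}
    {φ : ConformalEquiv upperHalfPlaneSet D.carrier} (hφ : D.IsChordalUniformizing φ) :
    ∃ G : ℂ → ℂ, (∀ u : ℂ, 0 ≤ u.im → G (φ.boundaryExtension u) = u) ∧
      DifferentiableOn ℂ G D.carrier ∧
      ContinuousOn G (closure D.carrier ∩ {w | w ≠ D.pt 1}) ∧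
      (∀ w ∈ frontier D.carrier, (G w).im = 0) ∧
      (∀ w ∈ closure D.carrier, w ≠ D.pt 1 → 0 ≤ (G w).im ∧ φ.boundaryExtension (G w) = w) := by
  obtain ⟨Ψ, hΨ⟩ := JordanDomain.exists_isDiscExtension
    JordanDomain.exists_continuousOn_extension_holds φ
  have hinj : InjOn Ψ (closedBall 0 1) := hΨ.bijOn.injOn
  have hright : ∀ w ∈ closure D.carrier,
      Function.invFunOn Ψ (closedBall 0 1) w ∈ closedBall (0 : ℂ) 1 ∧
        Ψ (Function.invFunOn Ψ (closedBall 0 1) w) = w := fun w hw ↦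
    ⟨Function.invFunOn_mem (hΨ.bijOn.surjOn hw), Function.invFunOn_eq (hΨ.bijOn.surjOn hw)⟩
  have hΨ1 : Ψ 1 = D.pt 1 := hΨ.apply_one_eq hφ.2
  have hne1 : ∀ w ∈ closure D.carrier, w ≠ D.pt 1 →
      Function.invFunOn Ψ (closedBall 0 1) w ≠ 1 := fun w hw hw1 h ↦ by
    have h' := (hright w hw).2
    rw [h, hΨ1] at h'
    exact hw1 h'.symm
  obtain ⟨G, hG⟩ : ∃ G : ℂ → ℂ, ∀ w,
      G w = cayleyInvFun (Function.invFunOn Ψ (closedBall 0 1) w) := ⟨_, fun w ↦ rfl⟩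
  have hGΦ : ∀ u : ℂ, 0 ≤ u.im → G (φ.boundaryExtension u) = u := fun u hu ↦ by
    rw [hG, hΨ.boundaryExtension_eq hu,
      hinj.leftInvOn_invFunOn (mem_closedBall_zero_iff.2 (norm_cayleyFun_le_one hu)),
      cayleyInvFun_cayleyFun (add_I_ne_zero hu)]
  have hGsymm : ∀ w ∈ D.carrier, G w = φ.symm w := fun w hw ↦ by
    have hw' : φ.symm w ∈ upperHalfPlaneSet := φ.symm_mapsTo hw
    have h1 : φ.boundaryExtension (φ.symm w) = w := by
      rw [φ.boundaryExtension_eq hw', φ.apply_symm_apply hw]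
    have h2 := hGΦ (φ.symm w) (le_of_lt hw')
    rwa [h1] at h2
  refine ⟨G, hGΦ, φ.symm.differentiableOn_coe.congr hGsymm, ?_, fun w hw ↦ ?_,
    fun w hw hw1 ↦ ?_⟩
  · have hΨinvc : ContinuousOn (Function.invFunOn Ψ (closedBall 0 1)) (closure D.carrier) := by
      rw [← hΨ.bijOn.image_eq]
      exact IsCompact.continuousOn_invFunOn (isCompact_closedBall 0 1) hΨ.continuousOn hinj
    rw [show G = cayleyInvFun ∘ Function.invFunOn Ψ (closedBall 0 1) from funext hG]
    exact differentiableOn_cayleyInvFun.continuousOn.comp (hΨinvc.mono inter_subset_left)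
      fun w hw ↦ hne1 w hw.1 hw.2
  · rw [hG]
    exact cayleyInvFun_im_eq_zero (mem_sphere_zero_iff_norm.1 (hΨ.invFunOn_mem_sphere hw).1)
  · obtain ⟨hζ, hΨζ⟩ := hright w hw
    have hζ1 := hne1 w hw hw1
    have him : 0 ≤ (G w).im := by
      rw [hG, cayleyInvFun_im]
      refine div_nonneg (sub_nonneg.2 ?_) (normSq_nonneg _)
      rw [normSq_eq_norm_sq]
      exact pow_le_one₀ (norm_nonneg _) (mem_closedBall_zero_iff.1 hζ)
    refine ⟨him, ?_⟩
    rw [hΨ.boundaryExtension_eq him, hG, cayleyFun_cayleyInvFun hζ1, hΨζ]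

/-! ### The stub -/

/-- **S6b — FLAT-WINDOW TRANSPORT.** Let `(D; a, b)` be a Dobrushin domain with a flat horizontal
window `D ∩ B(x₀, ρ₀) = {im z > im x₀} ∩ B(x₀, ρ₀)` at `x₀ ∉ {a, b}` and let `φ : ℍ → D` be a
chordal uniformizing map (`0 ↦ a`, `∞ ↦ b`), `Φ = φ.boundaryExtension`. Then `x₀ = Φ(u₀)` for
a real `u₀ ≠ 0` and there are `L, η > 0` with `|Φ(u) − x₀| ≤ L |u − u₀|` whenever `im u ≥ 0`,
`|u − u₀| < η`, and `|u − u₀| ≤ L |Φ(u) − x₀|` whenever `im u ≥ 0`, `|Φ(u) − x₀| < η`.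
Proof: `u₀ = G(x₀)` with `G` the inverse up to the boundary (`exists_inverse_upTo_boundary`);
the second clause is the one-sided Lipschitz bound of `G` at the wall point `x₀` of `D`, the
first that of `Φ − x₀` at the wall point `u₀` of `ℍ` (real points near `u₀` are mapped to
`∂D ∩ B(x₀, ρ₀)`, the wall line), both by `exists_norm_sub_le_of_window`; `u₀ ≠ 0` since
`Φ(0) = a ≠ x₀`. Pommerenke (1992), Thm. 2.6, with the Schwarz reflection principle. [folklore] -/
theorem stub_windowTransport :
    ∀ (D : DobrushinDomain) (x₀ : ℂ) (ρ₀ : ℝ), 0 < ρ₀ →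
      D.carrier ∩ Metric.ball x₀ ρ₀ = {z : ℂ | x₀.im < z.im} ∩ Metric.ball x₀ ρ₀ →
      x₀ ≠ D.pt 0 → x₀ ≠ D.pt 1 →
      ∀ (φ : ConformalEquiv upperHalfPlaneSet D.carrier), D.IsChordalUniformizing φ →
        ∃ u₀ L η : ℝ, u₀ ≠ 0 ∧ 0 < L ∧ 0 < η ∧
          ∀ u : ℂ, 0 ≤ u.im →
            (dist u (u₀ : ℂ) < η →
                dist (φ.boundaryExtension u) x₀ ≤ L * dist u (u₀ : ℂ)) ∧
            (dist (φ.boundaryExtension u) x₀ < η →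
                dist u (u₀ : ℂ) ≤ L * dist (φ.boundaryExtension u) x₀) := by
  intro D x₀ ρ₀ hρ₀ hwin hx0 hx1 φ hφ
  -- Carathéodory, half-plane form
  have hΦc : ContinuousOn φ.boundaryExtension (closure upperHalfPlaneSet) :=
    JordanDomain.continuousOn_boundaryExtension_holds D.toJordanDomain φ
  have hΦcl : ∀ u : ℂ, 0 ≤ u.im → φ.boundaryExtension u ∈ closure D.carrier := fun u hu ↦
    JordanDomain.mapsTo_boundaryExtension_holds D.toJordanDomain φ
      (mem_closure_upperHalfPlaneSet_iff.2 hu)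
  have hΦfr : ∀ u : ℂ, u.im = 0 → φ.boundaryExtension u ∈ frontier D.carrier := fun u hu ↦ by
    obtain ⟨p, hp, hbv⟩ := JordanDomain.exists_hasBoundaryValue_holds D.toJordanDomain φ u.re
    have hure : ((u.re : ℝ) : ℂ) = u := Complex.ext (by simp) (by simp [hu])
    rw [hure] at hbv
    rwa [φ.boundaryExtension_eq_of_hasBoundaryValue (mem_closure_upperHalfPlaneSet_iff.2 hu.ge)
      hbv]
  -- the wall point `x₀` and its real preimage `u₀ = G x₀`
  have hx₀fr : x₀ ∈ frontier D.carrier :=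
    ((window_mem_iff D.isOpen hwin (mem_ball_self hρ₀)).2.2).2 rfl
  have hx₀cl : x₀ ∈ closure D.carrier := frontier_subset_closure hx₀fr
  obtain ⟨G, hGΦ, hGd, hGc, hGreal, hGinv⟩ := exists_inverse_upTo_boundary hφ
  obtain ⟨-, hΦGx₀⟩ := hGinv x₀ hx₀cl hx1
  obtain ⟨u₀, hu₀⟩ : ∃ u₀ : ℝ, (u₀ : ℂ) = G x₀ :=
    ⟨(G x₀).re, Complex.ext (by simp) (by rw [ofReal_im, hGreal x₀ hx₀fr])⟩
  have hΦu₀ : φ.boundaryExtension u₀ = x₀ := by rw [hu₀]; exact hΦGx₀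
  have hu₀ne : u₀ ≠ 0 := by
    intro h
    apply hx0
    rw [← hΦu₀, h, ofReal_zero]
    exact φ.boundaryExtension_eq_of_hasBoundaryValue
      (mem_closure_upperHalfPlaneSet_iff.2 (by simp)) hφ.1
  -- second clause: reflect `G` across the wall at `x₀`
  obtain ⟨ρ₁, hρ₁, hρ₁ρ₀, hρ₁b⟩ : ∃ ρ₁ : ℝ, 0 < ρ₁ ∧ ρ₁ ≤ ρ₀ ∧ ∀ w ∈ ball x₀ ρ₁, w ≠ D.pt 1 := by
    refine ⟨min ρ₀ (dist (D.pt 1) x₀), lt_min hρ₀ (dist_pos.2 (Ne.symm hx1)), min_le_left _ _,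
      fun w hw h ↦ ?_⟩
    rw [h, mem_ball] at hw
    exact lt_irrefl _ (hw.trans_le (min_le_right _ _))
  obtain ⟨K₂, η₂, hK₂, hη₂, hη₂ρ, hLip₂⟩ := exists_norm_sub_le_of_window D.isOpen hρ₁
    (window_mono hwin hρ₁ρ₀) (hGd.mono inter_subset_left)
    (hGc.mono fun w hw ↦ ⟨hw.1, hρ₁b w hw.2⟩) fun w hw ↦ hGreal w hw.1
  -- first clause: reflect `Φ - x₀` across the real axis at `u₀`
  obtain ⟨δ, hδ, hδρ⟩ : ∃ δ > 0, ∀ u : ℂ, 0 ≤ u.im → dist u u₀ < δ →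
      φ.boundaryExtension u ∈ ball x₀ ρ₀ := by
    obtain ⟨δ, hδ, h⟩ := Metric.continuousWithinAt_iff.1
      (hΦc u₀ (mem_closure_upperHalfPlaneSet_iff.2 (by simp))) ρ₀ hρ₀
    refine ⟨δ, hδ, fun u hu hd ↦ ?_⟩
    have := h (mem_closure_upperHalfPlaneSet_iff.2 hu) hd
    rwa [hΦu₀] at this
  have hwinH : upperHalfPlaneSet ∩ ball (u₀ : ℂ) δ =
      {z : ℂ | (u₀ : ℂ).im < z.im} ∩ ball (u₀ : ℂ) δ := by
    rw [ofReal_im]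
  have hd₁ : DifferentiableOn ℂ (fun w ↦ φ.boundaryExtension w - x₀)
      (upperHalfPlaneSet ∩ ball (u₀ : ℂ) δ) :=
    ((φ.differentiableOn_coe.mono inter_subset_left).congr
      fun z hz ↦ φ.boundaryExtension_eq hz.1).sub_const x₀
  have hc₁ : ContinuousOn (fun w ↦ φ.boundaryExtension w - x₀)
      (closure upperHalfPlaneSet ∩ ball (u₀ : ℂ) δ) :=
    (hΦc.mono inter_subset_left).sub continuousOn_const
  have hr₁ : ∀ w ∈ frontier upperHalfPlaneSet ∩ ball (u₀ : ℂ) δ,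
      (φ.boundaryExtension w - x₀).im = 0 := by
    rintro w ⟨hw, hwb⟩
    have hwim : w.im = 0 := by
      rw [frontier_setOf_lt_im] at hw
      exact hw
    have h := ((window_mem_iff D.isOpen hwin (hδρ w hwim.ge (mem_ball.1 hwb))).2.2).1
      (hΦfr w hwim)
    rw [sub_im, h, sub_self]
  obtain ⟨K₁, η₁, hK₁, hη₁, -, hLip₁⟩ :=
    exists_norm_sub_le_of_window isOpen_upperHalfPlaneSet hδ hwinH hd₁ hc₁ hr₁
  -- assemble
  refine ⟨u₀, max (max K₁ K₂) 1, min η₁ η₂, hu₀ne, lt_max_of_lt_right one_pos, lt_min hη₁ hη₂,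
    fun u hu ↦ ⟨fun hd ↦ ?_, fun hd ↦ ?_⟩⟩
  · have hz : u - u₀ ∈ ball (0 : ℂ) η₁ := by
      rw [mem_ball_zero_iff, ← dist_eq_norm]
      exact hd.trans_le (min_le_left _ _)
    have h := hLip₁ (u - u₀) hz (by rw [sub_im, ofReal_im, sub_zero]; exact hu)
    simp only [add_sub_cancel, hΦu₀, sub_self, sub_zero] at h
    rw [dist_eq_norm, dist_eq_norm]
    calc ‖φ.boundaryExtension u - x₀‖ ≤ K₁ * ‖u - u₀‖ := h
      _ ≤ max (max K₁ K₂) 1 * ‖u - u₀‖ := by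
        gcongr
        exact le_max_of_le_left (le_max_left _ _)
  · have hball : φ.boundaryExtension u ∈ ball x₀ ρ₀ :=
      mem_ball.2 (hd.trans_le ((min_le_right _ _).trans (hη₂ρ.trans hρ₁ρ₀)))
    have him : x₀.im ≤ (φ.boundaryExtension u).im :=
      ((window_mem_iff D.isOpen hwin hball).2.1).1 (hΦcl u hu)
    have hz : φ.boundaryExtension u - x₀ ∈ ball (0 : ℂ) η₂ := by
      rw [mem_ball_zero_iff, ← dist_eq_norm]
      exact hd.trans_le (min_le_right _ _)
    have h := hLip₂ (φ.boundaryExtension u - x₀) hz (by rw [sub_im]; linarith)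
    rw [add_sub_cancel, hGΦ u hu, ← hu₀] at h
    rw [dist_eq_norm, dist_eq_norm]
    calc ‖u - u₀‖ ≤ K₂ * ‖φ.boundaryExtension u - x₀‖ := h
      _ ≤ max (max K₁ K₂) 1 * ‖φ.boundaryExtension u - x₀‖ := by
        gcongr
        exact le_max_of_le_left (le_max_right _ _)

end Summit.CriticalPhenomena.SAWScalingLimit.Theorems.SubseqIdentification.BoundaryAreaLaw

end
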